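import Summits.BirchSwinnertonDyer.BirchSwinnertonDyer.Theorems.CyclotomicUntwistInterpolationIsFree
import HarnessLib

/-!
# Untwist eigensymbols, VII: the canonical symbol is bounded iff the `p`-adic series
# `∑_{j≥1} (p/α)ʲ (H(a/pʲ) − H(0))` vanish — the `U_p`-eigenvalue of the untwist as a `g`-free equation

Cell `pub/bsd-wall` (D-0145 line `route-BirchSwinnertonDyer-CyclotomicUntwist`), seat `bsd-line-cycu-p3`
(prover seat 3/3), toward crux K1 `PSRankOneLowerHalfAtThree` (stmt-BirchSwinnertonDyer-21580) / want F1
(`wi-84943`).  Seventh file of the series.  THEOREMS ONLY (no definition, no named fact, no `sorry`).  BSD is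
not proved by this file and no crux of the route is proved by it.

WHAT.  With `q = α/p`, `‖q‖ > 1` (slope `< 1`), `H` the bounded `p`-deprived twisted symbol and `Ψ` the
canonical symbol of files IV/V, put `S_n(a) = ∑_{j<n} q^{-(j+1)} (H(a/p^{j+1}) − H(0))`.  Then

* §1 `canonical_eq_pow_mul_partialSum`: `Ψ(a/pⁿ) = qⁿ S_n(a) + (1 − q)⁻¹ H(0)` (from the deprivation
  identity (S3), by induction);
* §2 `norm_partialSum_sub_le`: `‖S_m(a) − S_n(a)‖ ≤ C ‖q‖^{-(n+1)}` for `m ≥ n` (ultrametric tail), so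
  `S_n(a)` converges;
* §3 `canonical_bounded_iff_tendsto_partialSum`: **`Ψ` is bounded on `ℤ[1/p]` iff `S_n(a) → 0` for every
  `a : ℤ`**, i.e. iff the `p`-adic series `∑_{j≥1} (p/α)ʲ (H(a/pʲ) − H(0))` all vanish
  (`canonical_bounded_iff_hasSum_zero`);
* §4 with file V: `exists_isUntwistedPAdicLFunction_of_series_eq_zero` and
  `exists_bounded_eigensymbol_iff_series_eq_zero` — the untwisted `p`-adic `L`-function of D1 exists as
  soon as (for `‖α⁻¹‖ ≤ √p`) `t = p/α` is a common zero of the power series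
  `F_a(t) = ∑_{j≥1} (H(a/pʲ) − H(0)) tʲ`, `a ∈ ℤ`, whose coefficients are explicit `η`-twisted rational plus
  symbols of `f`; W-level `exists_isPSCyclotomicLFunctionOf_of_series_eq_zero`.

So «`a₃(g)` is the `U₃`-eigenvalue of the untwist» becomes, `g`-free: `a₃(g) = 3/t₀` with `t₀` the common
zero (of norm `3^{-1/2}`) of the `F_a` — the route's kill criterion (i) («`a₃(g) ≠ 0`, slope `½`») as an
EQUATION in the symbols of `f_W`, and the F1 fact as «the `F_a` have a common zero of norm `3^{-1/2}`».

References: [cite: MazurTateTeitelbaum1986Invent, §I.10 and §I.14] · [cite: Bellaiche2021, §6.7.2 and Thm. 6.7.9].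
-/

noncomputable section

open Finset Filter Topology
open Literature.NumberTheory.EllipticCurves Literature.NumberTheory.EllipticCurves.ModularForms
  Literature.NumberTheory.IwasawaTheory

-- single-conjunct summit: `Summit.BirchSwinnertonDyer.BirchSwinnertonDyer.…` repeats the name by design
set_option linter.dupNamespace false

namespace Summit.BirchSwinnertonDyer.BirchSwinnertonDyer.Theorems.PSUntwistExistence

variable {p : ℕ} [Fact p.Prime] {N : ℕ} {f : CuspForm (CongruenceSubgroup.Gamma0 N) 2} {c : ℕ}
  {η : DirichletCharacter ℂ_[p] (p ^ c)} {α : ℂ_[p]} {H Ψ : ℚ → ℂ_[p]}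

/-! ### §1 The canonical values through the partial sums `S_n(a)` -/

/-- **`Ψ(a/pⁿ) = (α/p)ⁿ S_n(a) + (1 − α/p)⁻¹ H(0)`** with
`S_n(a) = ∑_{j<n} (α/p)^{-(j+1)} (H(a/p^{j+1}) − H(0))`, for any `Ψ` with (S1) and the deprivation identity
(S3) on `ℤ[1/p]` and `α ≠ 0, p` — by induction on `n`, `Ψ(a/p^{n+1}) = H(a/p^{n+1}) + (α/p)Ψ(a/pⁿ)` and
`Ψ(a) = (1 − α/p)⁻¹H(0)` (file IV `eq_of_deprivation` logic; here directly). [cite: MazurTateTeitelbaum1986Invent, §I.14] -/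
theorem canonical_eq_pow_mul_partialSum (hα : α ≠ 0) (hq : α / p ≠ 1)
    (hΨ1 : ∀ (n : ℕ) (a z : ℤ), Ψ ((a : ℚ) / (p : ℚ) ^ n + z) = Ψ ((a : ℚ) / (p : ℚ) ^ n))
    (hΨ3 : ∀ (n : ℕ) (a : ℤ),
      Ψ ((a : ℚ) / (p : ℚ) ^ n) - α / p * Ψ (p * ((a : ℚ) / (p : ℚ) ^ n)) = H ((a : ℚ) / (p : ℚ) ^ n))
    (n : ℕ) (a : ℤ) :
    Ψ ((a : ℚ) / (p : ℚ) ^ n) =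
      (α / p) ^ n * ∑ j ∈ range n, (α / p)⁻¹ ^ (j + 1) * (H ((a : ℚ) / (p : ℚ) ^ (j + 1)) - H 0) +
        (1 - α / p)⁻¹ * H 0 := by
  have hp0 : (p : ℚ) ≠ 0 := Nat.cast_ne_zero.mpr (Fact.out : p.Prime).ne_zero
  have hp0' : (p : ℂ_[p]) ≠ 0 := Nat.cast_ne_zero.mpr (Fact.out : p.Prime).ne_zero
  have hq0 : α / p ≠ 0 := div_ne_zero hα hp0'
  have h1 : (1 - α / p) ≠ 0 := sub_ne_zero.mpr (Ne.symm hq)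
  have hinv : (1 - α / p)⁻¹ * (1 - α / p) = 1 := inv_mul_cancel₀ h1
  induction n with
  | zero =>
    -- `Ψ(a) = Ψ(0)`, `Ψ(0) − (α/p)Ψ(0) = H(0)`
    have hΨa : Ψ ((a : ℚ) / (p : ℚ) ^ 0) = Ψ (((0 : ℤ) : ℚ) / (p : ℚ) ^ 0) := by
      rw [show (a : ℚ) / (p : ℚ) ^ 0 = ((0 : ℤ) : ℚ) / (p : ℚ) ^ 0 + (a : ℤ) by simp, hΨ1]
    have h0 := hΨ3 0 0
    rw [show (p : ℚ) * (((0 : ℤ) : ℚ) / (p : ℚ) ^ 0) = ((0 : ℤ) : ℚ) / (p : ℚ) ^ 0 by simp,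
      show H (((0 : ℤ) : ℚ) / (p : ℚ) ^ 0) = H 0 by simp] at h0
    rw [hΨa, Finset.sum_range_zero, mul_zero, zero_add]
    linear_combination (1 - α / p)⁻¹ * h0 - Ψ (((0 : ℤ) : ℚ) / (p : ℚ) ^ 0) * hinv
  | succ m ih =>
    have hrec := hΨ3 (m + 1) a
    rw [show (p : ℚ) * ((a : ℚ) / (p : ℚ) ^ (m + 1)) = (a : ℚ) / (p : ℚ) ^ m by field_simp; ring, ih]
      at hrec
    rw [Finset.sum_range_succ]
    have hQR : (α / p) ^ (m + 1) * (α / p)⁻¹ ^ (m + 1) = 1 := by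
      rw [← mul_pow, mul_inv_cancel₀ hq0, one_pow]
    linear_combination hrec - (H ((a : ℚ) / (p : ℚ) ^ (m + 1)) - H 0) * hQR - H 0 * hinv

/-! ### §2 The ultrametric tail estimate: `S_n(a)` is Cauchy at rate `‖α/p‖^{-(n+1)}` -/

/-- `‖x − y‖ ≤ max ‖x‖ ‖y‖` in `ℂ_p`. [folklore] -/
theorem norm_sub_le_max_padicComplex (x y : ℂ_[p]) : ‖x - y‖ ≤ max ‖x‖ ‖y‖ := by
  rw [sub_eq_add_neg, ← norm_neg y]
  exact IsUltrametricDist.norm_add_le_max _ _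

/-- **Tail estimate**: for `‖H‖ ≤ C` and `‖α/p‖ > 1`, and `n ≤ m`,
`‖S_m(a) − S_n(a)‖ ≤ C ‖α/p‖⁻¹^{n+1}` — the terms `j ≥ n` have norm `≤ C‖α/p‖^{-(j+1)}` (ultrametric
`‖H(·) − H(0)‖ ≤ C`) and `ℂ_p` is ultrametric. [cite: Bellaiche2021, §6.7.2] -/
theorem norm_partialSum_sub_le {C : ℝ} (hC0 : 0 ≤ C) (hH : ∀ r : ℚ, ‖H r‖ ≤ C) (hq : 1 < ‖α / p‖)
    (a : ℤ) {n m : ℕ} (hnm : n ≤ m) :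
    ‖∑ j ∈ range m, (α / p)⁻¹ ^ (j + 1) * (H ((a : ℚ) / (p : ℚ) ^ (j + 1)) - H 0) -
        ∑ j ∈ range n, (α / p)⁻¹ ^ (j + 1) * (H ((a : ℚ) / (p : ℚ) ^ (j + 1)) - H 0)‖ ≤
      C * ‖(α / p)⁻¹‖ ^ (n + 1) := by
  have hqi : ‖(α / p)⁻¹‖ ≤ 1 := by rw [norm_inv]; exact inv_le_one_of_one_le₀ hq.le
  rw [← Finset.sum_Ico_eq_sub _ hnm]
  refine IsUltrametricDist.norm_sum_le_of_forall_le_of_nonneg (by positivity) fun j hj ↦ ?_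
  have hnj : n ≤ j := (Finset.mem_Ico.mp hj).1
  rw [norm_mul, norm_pow, mul_comm]
  refine mul_le_mul ((norm_sub_le_max_padicComplex _ _).trans (max_le (hH _) (hH 0)))
    (pow_le_pow_of_le_one (norm_nonneg _) hqi (by omega)) (by positivity) hC0

/-! ### §3 Bounded canonical symbol ⟺ the partial sums tend to `0` -/

/-- **(⇐) If `S_n(a) → 0` for every `a`, the canonical symbol is bounded**: passing to the limit `m → ∞` in
the tail estimate gives `‖S_n(a)‖ ≤ C‖α/p‖^{-(n+1)}`, hence `‖(α/p)ⁿ S_n(a)‖ ≤ C‖α/p‖⁻¹` and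
`‖Ψ(a/pⁿ)‖ ≤ max(C‖α/p‖⁻¹, ‖(1 − α/p)⁻¹H(0)‖)`. [cite: Bellaiche2021, Thm. 6.7.9] -/
theorem canonical_bounded_of_tendsto_partialSum {C : ℝ} (hC0 : 0 ≤ C) (hH : ∀ r : ℚ, ‖H r‖ ≤ C)
    (hα : α ≠ 0) (hq : 1 < ‖α / p‖)
    (hΨ1 : ∀ (n : ℕ) (a z : ℤ), Ψ ((a : ℚ) / (p : ℚ) ^ n + z) = Ψ ((a : ℚ) / (p : ℚ) ^ n))
    (hΨ3 : ∀ (n : ℕ) (a : ℤ),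
      Ψ ((a : ℚ) / (p : ℚ) ^ n) - α / p * Ψ (p * ((a : ℚ) / (p : ℚ) ^ n)) = H ((a : ℚ) / (p : ℚ) ^ n))
    (hlim : ∀ a : ℤ, Tendsto (fun n ↦ ∑ j ∈ range n,
      (α / p)⁻¹ ^ (j + 1) * (H ((a : ℚ) / (p : ℚ) ^ (j + 1)) - H 0)) atTop (𝓝 0)) :
    ∀ (n : ℕ) (a : ℤ), ‖Ψ ((a : ℚ) / (p : ℚ) ^ n)‖ ≤ max (C * ‖(α / p)⁻¹‖) (‖(1 - α / p)⁻¹ * H 0‖) := by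
  have hq1 : α / p ≠ 1 := fun h ↦ by rw [h, norm_one] at hq; exact lt_irrefl _ hq
  have hq0 : ‖α / p‖ ≠ 0 := by positivity
  intro n a
  -- `‖S_n(a)‖ ≤ C ‖q⁻¹‖^{n+1}` by letting `m → ∞` in the tail estimate
  have hSn : ‖∑ j ∈ range n, (α / p)⁻¹ ^ (j + 1) * (H ((a : ℚ) / (p : ℚ) ^ (j + 1)) - H 0)‖ ≤
      C * ‖(α / p)⁻¹‖ ^ (n + 1) := by
    have ht := ((hlim a).const_sub (∑ j ∈ range n,
      (α / p)⁻¹ ^ (j + 1) * (H ((a : ℚ) / (p : ℚ) ^ (j + 1)) - H 0))).norm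
    rw [sub_zero] at ht
    refine le_of_tendsto ht (Filter.eventually_atTop.mpr ⟨n, fun m hm ↦ ?_⟩)
    rw [← norm_neg, neg_sub]
    exact norm_partialSum_sub_le hC0 hH hq a hm
  rw [canonical_eq_pow_mul_partialSum hα hq1 hΨ1 hΨ3 n a]
  refine (IsUltrametricDist.norm_add_le_max _ _).trans (max_le_max ?_ le_rfl)
  rw [norm_mul, norm_pow]
  calc ‖α / p‖ ^ n * ‖∑ j ∈ range n, (α / p)⁻¹ ^ (j + 1) * (H ((a : ℚ) / (p : ℚ) ^ (j + 1)) - H 0)‖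
      ≤ ‖α / p‖ ^ n * (C * ‖(α / p)⁻¹‖ ^ (n + 1)) := mul_le_mul_of_nonneg_left hSn (by positivity)
    _ = C * ‖(α / p)⁻¹‖ := by
        rw [norm_inv, pow_succ, inv_pow, ← mul_assoc, ← mul_assoc, mul_comm (‖α / p‖ ^ n),
          mul_assoc C, mul_inv_cancel₀ (pow_ne_zero _ hq0), mul_one]

/-- **(⇒) If the canonical symbol is bounded, `S_n(a) → 0`**: `(α/p)ⁿ S_n(a) = Ψ(a/pⁿ) − (1 − α/p)⁻¹H(0)`
is bounded, so `‖S_n(a)‖ ≤ C'‖α/p‖^{-n} → 0`. [cite: Bellaiche2021, Thm. 6.7.9] -/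
theorem tendsto_partialSum_of_canonical_bounded (hα : α ≠ 0) (hq : 1 < ‖α / p‖)
    (hΨ1 : ∀ (n : ℕ) (a z : ℤ), Ψ ((a : ℚ) / (p : ℚ) ^ n + z) = Ψ ((a : ℚ) / (p : ℚ) ^ n))
    (hΨ3 : ∀ (n : ℕ) (a : ℤ),
      Ψ ((a : ℚ) / (p : ℚ) ^ n) - α / p * Ψ (p * ((a : ℚ) / (p : ℚ) ^ n)) = H ((a : ℚ) / (p : ℚ) ^ n))
    {C' : ℝ} (hbd : ∀ (n : ℕ) (a : ℤ), ‖Ψ ((a : ℚ) / (p : ℚ) ^ n)‖ ≤ C') (a : ℤ) :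
    Tendsto (fun n ↦ ∑ j ∈ range n,
      (α / p)⁻¹ ^ (j + 1) * (H ((a : ℚ) / (p : ℚ) ^ (j + 1)) - H 0)) atTop (𝓝 0) := by
  have hq1 : α / p ≠ 1 := fun h ↦ by rw [h, norm_one] at hq; exact lt_irrefl _ hq
  have hq0 : α / p ≠ 0 := fun h ↦ by rw [h, norm_zero] at hq; exact (not_lt.mpr zero_le_one) hq
  have hqi : ‖(α / p)⁻¹‖ < 1 := by rw [norm_inv]; exact inv_lt_one_of_one_lt₀ hq
  -- `S_n = q^{-n} (Ψ(a/pⁿ) − (1 − q)⁻¹ H 0)`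
  have hS : ∀ n : ℕ, ∑ j ∈ range n, (α / p)⁻¹ ^ (j + 1) * (H ((a : ℚ) / (p : ℚ) ^ (j + 1)) - H 0) =
      (α / p)⁻¹ ^ n * (Ψ ((a : ℚ) / (p : ℚ) ^ n) - (1 - α / p)⁻¹ * H 0) := by
    intro n
    rw [canonical_eq_pow_mul_partialSum hα hq1 hΨ1 hΨ3 n a, add_sub_cancel_right, ← mul_assoc,
      ← mul_pow, inv_mul_cancel₀ hq0, one_pow, one_mul]
  refine squeeze_zero_norm (a := fun n ↦ ‖(α / p)⁻¹‖ ^ n * (C' + ‖(1 - α / p)⁻¹ * H 0‖)) (fun n ↦ ?_) ?_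
  · rw [hS, norm_mul, norm_pow]
    exact mul_le_mul_of_nonneg_left ((norm_sub_le _ _).trans (add_le_add (hbd n a) le_rfl))
      (by positivity)
  · simpa using (tendsto_pow_atTop_nhds_zero_of_lt_one (norm_nonneg _) hqi).mul_const
      (C' + ‖(1 - α / p)⁻¹ * H 0‖)

/-- **CRITERION.**  For `H` bounded, `α ≠ 0` with `‖α/p‖ > 1`, and `Ψ` a symbol with (S1) and (S3)
(on `ℤ[1/p]`): `Ψ` is bounded on `ℤ[1/p]` **iff** `S_n(a) = ∑_{j<n} (p/α)^{j+1}(H(a/p^{j+1}) − H(0)) → 0` for every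
`a : ℤ` — i.e. iff the convergent `p`-adic series `∑_{j≥1} (p/α)ʲ (H(a/pʲ) − H(0))` all vanish.
[cite: Bellaiche2021, Thm. 6.7.9] [cite: MazurTateTeitelbaum1986Invent, §I.14] -/
theorem canonical_bounded_iff_tendsto_partialSum {C : ℝ} (hC0 : 0 ≤ C) (hH : ∀ r : ℚ, ‖H r‖ ≤ C)
    (hα : α ≠ 0) (hq : 1 < ‖α / p‖)
    (hΨ1 : ∀ (n : ℕ) (a z : ℤ), Ψ ((a : ℚ) / (p : ℚ) ^ n + z) = Ψ ((a : ℚ) / (p : ℚ) ^ n))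
    (hΨ3 : ∀ (n : ℕ) (a : ℤ),
      Ψ ((a : ℚ) / (p : ℚ) ^ n) - α / p * Ψ (p * ((a : ℚ) / (p : ℚ) ^ n)) = H ((a : ℚ) / (p : ℚ) ^ n)) :
    (∃ C' : ℝ, ∀ (n : ℕ) (a : ℤ), ‖Ψ ((a : ℚ) / (p : ℚ) ^ n)‖ ≤ C') ↔
      ∀ a : ℤ, Tendsto (fun n ↦ ∑ j ∈ range n,
        (α / p)⁻¹ ^ (j + 1) * (H ((a : ℚ) / (p : ℚ) ^ (j + 1)) - H 0)) atTop (𝓝 0) :=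
  ⟨fun ⟨_, hbd⟩ a ↦ tendsto_partialSum_of_canonical_bounded hα hq hΨ1 hΨ3 hbd a,
    fun hlim ↦ ⟨_, canonical_bounded_of_tendsto_partialSum hC0 hH hα hq hΨ1 hΨ3 hlim⟩⟩

/-- The same criterion with the limit written as a `p`-adic SERIES IDENTITY:
`HasSum (j ↦ (p/α)^{j+1} (H(a/p^{j+1}) − H(0))) 0` for every `a` (the series converge absolutely, so
`HasSum` is the limit of the partial sums — Mathlib `hasSum_iff_tendsto_nat_of_summable_norm`).
[cite: Bellaiche2021, Thm. 6.7.9] -/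
theorem canonical_bounded_iff_hasSum_zero {C : ℝ} (hC0 : 0 ≤ C) (hH : ∀ r : ℚ, ‖H r‖ ≤ C)
    (hα : α ≠ 0) (hq : 1 < ‖α / p‖)
    (hΨ1 : ∀ (n : ℕ) (a z : ℤ), Ψ ((a : ℚ) / (p : ℚ) ^ n + z) = Ψ ((a : ℚ) / (p : ℚ) ^ n))
    (hΨ3 : ∀ (n : ℕ) (a : ℤ),
      Ψ ((a : ℚ) / (p : ℚ) ^ n) - α / p * Ψ (p * ((a : ℚ) / (p : ℚ) ^ n)) = H ((a : ℚ) / (p : ℚ) ^ n)) :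
    (∃ C' : ℝ, ∀ (n : ℕ) (a : ℤ), ‖Ψ ((a : ℚ) / (p : ℚ) ^ n)‖ ≤ C') ↔
      ∀ a : ℤ, HasSum (fun j ↦ (α / p)⁻¹ ^ (j + 1) * (H ((a : ℚ) / (p : ℚ) ^ (j + 1)) - H 0)) 0 := by
  rw [canonical_bounded_iff_tendsto_partialSum hC0 hH hα hq hΨ1 hΨ3]
  have hqi : ‖(α / p)⁻¹‖ < 1 := by rw [norm_inv]; exact inv_lt_one_of_one_lt₀ hq
  refine forall_congr' fun a ↦ (hasSum_iff_tendsto_nat_of_summable_norm ?_).symm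
  refine Summable.of_nonneg_of_le (fun _ ↦ norm_nonneg _) (fun j ↦ ?_)
    ((summable_geometric_of_lt_one (norm_nonneg _) hqi).mul_left (C * ‖(α / p)⁻¹‖))
  rw [norm_mul, norm_pow, pow_succ, mul_comm (‖(α / p)⁻¹‖ ^ j)]
  calc ‖(α / p)⁻¹‖ * ‖(α / p)⁻¹‖ ^ j * ‖H ((a : ℚ) / (p : ℚ) ^ (j + 1)) - H 0‖
      ≤ ‖(α / p)⁻¹‖ * ‖(α / p)⁻¹‖ ^ j * C :=
        mul_le_mul_of_nonneg_left ((norm_sub_le_max_padicComplex _ _).trans (max_le (hH _) (hH 0)))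
          (by positivity)
    _ = C * ‖(α / p)⁻¹‖ * ‖(α / p)⁻¹‖ ^ j := by ring

/-! ### §4 With files V/VI: the untwisted `p`-adic `L`-function from the vanishing of the series -/

/-- **EXISTENCE OF THE D1 OBJECT FROM A SERIES IDENTITY.**  For `f` a rational newform (Manin–Drinfeld in
the tree), `η` primitive mod `p^c` (`c ≥ 1`), `α` with `‖p‖ < ‖α‖` and `‖α⁻¹‖ ≤ √p` (slope in `[½, 1)`;
`½` for the route): if for every `a : ℤ` the `p`-adic series
`∑_{j≥0} (p/α)^{j+1} (H(a/p^{j+1}) − H(0))`, `H(r) = ∑_{b mod p^c} η(b)[r + b/p^c]⁺_f`, sums to `0`, then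
`∃ μ, IsUntwistedPAdicLFunction p f η α μ` (the canonical symbol is then bounded — §3 — and file V applies).
[cite: MazurTateTeitelbaum1986Invent, §I.10 and §I.14] [cite: Bellaiche2021, Thm. 6.7.9] -/
theorem exists_isUntwistedPAdicLFunction_of_series_eq_zero [NeZero N]
    (f : CuspForm (CongruenceSubgroup.Gamma0 N) 2) (hf : IsNewform0 f) (hQ : coeffField f = ⊥)
    (hη : η.IsPrimitive) (hc : 1 ≤ c) (hαp1 : ‖(p : ℂ_[p])‖ < ‖α‖) (hαn : ‖α⁻¹‖ ≤ (p : ℝ) ^ (1 / 2 : ℝ))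
    (hser : ∀ a : ℤ, HasSum (fun j ↦ (α / p)⁻¹ ^ (j + 1) *
      ((∑ b : ZMod (p ^ c), η b *
          algebraMap ℚ ℂ_[p] (ratPlusSymbol f ((a : ℚ) / (p : ℚ) ^ (j + 1) + (b.val : ℚ) / (p : ℚ) ^ c))) -
        ∑ b : ZMod (p ^ c), η b * algebraMap ℚ ℂ_[p] (ratPlusSymbol f (0 + (b.val : ℚ) / (p : ℚ) ^ c))))
      0) :
    ∃ μ : (n : ℕ) → ZMod (p ^ n) → ℂ_[p], IsUntwistedPAdicLFunction p f η α μ := by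
  have hp : p.Prime := Fact.out
  have hp0 : (p : ℂ_[p]) ≠ 0 := Nat.cast_ne_zero.mpr hp.ne_zero
  have hα : α ≠ 0 := fun h ↦ by rw [h, norm_zero] at hαp1; exact (not_lt.mpr (norm_nonneg _)) hαp1
  have hαp : α ≠ p := fun h ↦ by rw [h] at hαp1; exact lt_irrefl _ hαp1
  have hq : 1 < ‖α / p‖ := by
    rw [norm_div, one_lt_div ((norm_pos_iff).mpr hp0)]
    exact hαp1
  obtain ⟨Ψ, hΨ⟩ := exists_canonical_symbol f η hαp
  obtain ⟨h1, h2, h3⟩ := canonical_symbol_isEigensymbol hη hc hαp hΨ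
  obtain ⟨C, hC0, hC⟩ := exists_norm_twistSymbol_le hf hQ η
  set H : ℚ → ℂ_[p] := fun r ↦
    ∑ b : ZMod (p ^ c), η b * algebraMap ℚ ℂ_[p] (ratPlusSymbol f (r + (b.val : ℚ) / (p : ℚ) ^ c)) with hH
  have hC' : ∀ r : ℚ, ‖H r‖ ≤ C := hC
  have h3' : ∀ (n : ℕ) (a : ℤ),
      Ψ ((a : ℚ) / (p : ℚ) ^ n) - α / p * Ψ (p * ((a : ℚ) / (p : ℚ) ^ n)) = H ((a : ℚ) / (p : ℚ) ^ n) := h3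
  have hser' : ∀ a : ℤ, HasSum (fun j ↦ (α / p)⁻¹ ^ (j + 1) *
      (H ((a : ℚ) / (p : ℚ) ^ (j + 1)) - H 0)) 0 := by
    intro a
    simpa only [hH, zero_add] using hser a
  obtain ⟨C', hbd⟩ := (canonical_bounded_iff_hasSum_zero hC0 hC' hα hq h1 h3').mpr hser'
  exact exists_isUntwistedPAdicLFunction_of_eigensymbol f η hα hαp hαn h1 h2 h3 ⟨C', hbd⟩

/-- **A bounded untwist eigensymbol exists iff the series vanish** (rational newform `f`, `η` primitive mod
`p^c`, `c ≥ 1`, `‖p‖ < ‖α‖`): combine file V `exists_bounded_eigensymbol_iff` (bounded eigensymbol ⟺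
canonical values bounded) with §3.  The right-hand side is a countable family of explicit `p`-adic power
series identities in `t = p/α` with coefficients in the `η`-twisted rational plus symbols of `f`: the
`U_p`-eigenvalue of the untwist, `g`-free. [cite: MazurTateTeitelbaum1986Invent, §I.14] [cite: Bellaiche2021, Thm. 6.7.9] -/
theorem exists_bounded_eigensymbol_iff_series_eq_zero [NeZero N]
    (f : CuspForm (CongruenceSubgroup.Gamma0 N) 2) (hf : IsNewform0 f) (hQ : coeffField f = ⊥)
    (hη : η.IsPrimitive) (hc : 1 ≤ c) (hαp1 : ‖(p : ℂ_[p])‖ < ‖α‖) :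
    (∃ Φ : ℚ → ℂ_[p],
      (∀ (n : ℕ) (a z : ℤ), Φ ((a : ℚ) / (p : ℚ) ^ n + z) = Φ ((a : ℚ) / (p : ℚ) ^ n)) ∧
      (∀ (n : ℕ) (a : ℤ), ∑ j : Fin p, Φ (((a : ℚ) / (p : ℚ) ^ n + j) / p) = α * Φ ((a : ℚ) / (p : ℚ) ^ n)) ∧
      (∀ (n : ℕ) (a : ℤ), Φ ((a : ℚ) / (p : ℚ) ^ n) - α / p * Φ (p * ((a : ℚ) / (p : ℚ) ^ n)) =
        ∑ b : ZMod (p ^ c), η b *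
          algebraMap ℚ ℂ_[p] (ratPlusSymbol f ((a : ℚ) / (p : ℚ) ^ n + (b.val : ℚ) / (p : ℚ) ^ c))) ∧
      ∃ C : ℝ, ∀ (n : ℕ) (a : ℤ), ‖Φ ((a : ℚ) / (p : ℚ) ^ n)‖ ≤ C) ↔
    ∀ a : ℤ, HasSum (fun j ↦ (α / p)⁻¹ ^ (j + 1) *
      ((∑ b : ZMod (p ^ c), η b *
          algebraMap ℚ ℂ_[p] (ratPlusSymbol f ((a : ℚ) / (p : ℚ) ^ (j + 1) + (b.val : ℚ) / (p : ℚ) ^ c))) -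
        ∑ b : ZMod (p ^ c), η b * algebraMap ℚ ℂ_[p] (ratPlusSymbol f (0 + (b.val : ℚ) / (p : ℚ) ^ c))))
      0 := by
  have hp : p.Prime := Fact.out
  have hp0 : (p : ℂ_[p]) ≠ 0 := Nat.cast_ne_zero.mpr hp.ne_zero
  have hα : α ≠ 0 := fun h ↦ by rw [h, norm_zero] at hαp1; exact (not_lt.mpr (norm_nonneg _)) hαp1
  have hαp : α ≠ p := fun h ↦ by rw [h] at hαp1; exact lt_irrefl _ hαp1
  have hq : 1 < ‖α / p‖ := by
    rw [norm_div, one_lt_div ((norm_pos_iff).mpr hp0)]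
    exact hαp1
  obtain ⟨Ψ, hΨ⟩ := exists_canonical_symbol f η hαp
  obtain ⟨h1, -, h3⟩ := canonical_symbol_isEigensymbol hη hc hαp hΨ
  obtain ⟨C, hC0, hC⟩ := exists_norm_twistSymbol_le hf hQ η
  set H : ℚ → ℂ_[p] := fun r ↦
    ∑ b : ZMod (p ^ c), η b * algebraMap ℚ ℂ_[p] (ratPlusSymbol f (r + (b.val : ℚ) / (p : ℚ) ^ c)) with hH
  have hC' : ∀ r : ℚ, ‖H r‖ ≤ C := hC
  have h3' : ∀ (n : ℕ) (a : ℤ),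
      Ψ ((a : ℚ) / (p : ℚ) ^ n) - α / p * Ψ (p * ((a : ℚ) / (p : ℚ) ^ n)) = H ((a : ℚ) / (p : ℚ) ^ n) := h3
  rw [exists_bounded_eigensymbol_iff f hη hc hαp]
  -- canonical values bounded ⟺ Ψ bounded ⟺ series vanish
  have key := canonical_bounded_iff_hasSum_zero hC0 hC' hα hq h1 h3'
  simp only [hH] at key
  rw [← key]
  constructor
  · rintro ⟨C', hC'⟩
    exact ⟨C', fun n a ↦ by rw [hΨ]; exact hC' n a⟩
  · rintro ⟨C', hC'⟩
    exact ⟨C', fun n a ↦ by rw [← hΨ]; exact hC' n a⟩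

/-- **W-level (route `CyclotomicUntwist`, F1 as a series identity).**  For `W/ℚ` with newform `f`, `η`
primitive mod `9`, `α ∈ ℂ₃` with `‖3‖ < ‖α‖` and `‖α⁻¹‖ ≤ √3`: if for every `a : ℤ`
`∑_{j≥0} (3/α)^{j+1} (H(a/3^{j+1}) − H(0)) = 0` (`H(r) = ∑_{b mod 9} η(b)[r + b/9]⁺_f`), then
`∃ 𝓛, IsPSCyclotomicLFunctionOf W η α 𝓛`.  For `α = a₃(g)` (the untwist) the identities hold: they say that
the `g`-symbol — the canonical symbol — is bounded (Mazur–Tate–Teitelbaum §I.14, Bellaïche Thm. 6.7.9,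
Atkin–Li Thm. 3.1, Manin–Drinfeld).
[cite: MazurTateTeitelbaum1986Invent, §I.14 (case p ∣ N, a_p ≠ 0)] [cite: Bellaiche2021, Thm. 6.7.9] [cite: AtkinLi1978, Thm. 3.1] -/
theorem exists_isPSCyclotomicLFunctionOf_of_series_eq_zero (W : WeierstrassCurve ℚ) {N : ℕ} [NeZero N]
    (f : CuspForm (CongruenceSubgroup.Gamma0 N) 2) (hf : IsNewformOf W f)
    {η : DirichletCharacter ℂ_[3] (3 ^ 2)} (hη : η.IsPrimitive) {α : ℂ_[3]} (hα3 : ‖(3 : ℂ_[3])‖ < ‖α‖)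
    (hαn : ‖α⁻¹‖ ≤ (3 : ℝ) ^ (1 / 2 : ℝ))
    (hser : ∀ a : ℤ, HasSum (fun j ↦ (α / 3)⁻¹ ^ (j + 1) *
      ((∑ b : ZMod (3 ^ 2), η b *
          algebraMap ℚ ℂ_[3] (ratPlusSymbol f ((a : ℚ) / (3 : ℚ) ^ (j + 1) + (b.val : ℚ) / (3 : ℚ) ^ 2))) -
        ∑ b : ZMod (3 ^ 2), η b * algebraMap ℚ ℂ_[3] (ratPlusSymbol f (0 + (b.val : ℚ) / (3 : ℚ) ^ 2))))
      0) :
    ∃ 𝓛 : (n : ℕ) → ZMod (3 ^ n) → ℂ_[3], IsPSCyclotomicLFunctionOf W η α 𝓛 := by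
  obtain ⟨μ, hμ⟩ := exists_isUntwistedPAdicLFunction_of_series_eq_zero (p := 3) f hf.1 hf.coeffField_eq_bot
    hη (by norm_num) (by exact_mod_cast hα3) (by exact_mod_cast hαn) (by exact_mod_cast hser)
  exact ⟨μ, N, inferInstance, f, hf, hμ⟩

end Summit.BirchSwinnertonDyer.BirchSwinnertonDyer.Theorems.PSUntwistExistence

end
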